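import Mathlib
import Summits.NavierStokesRegularity.NavierStokesRegularity.Theorems.TaoLadderRungThreeGappedFrontRobustComparison
import Summits.NavierStokesRegularity.NavierStokesRegularity.Theorems.TaoLadderRungTwoFlatGappedFrontRobustQuadTermOn
import HarnessLib

/-!
# Shift-set pseudo-flows (`PseudoFlowOnShift 𝕊`): THE FROZEN WAKE — the shells behind a window barely move
  over one clock window (helper for item stmt-NavierStokesRegularity-22988 `GappedFrontRobustV2Flat`,
  crux K_B♭ of route TaoLadderRungTwoFlat; serves equally the wake-feed step of any finite-window
  certificate on a nearest-neighbour shift set, cf. theory-1's NUM-T28…T31 and the window routes on TL-M3)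

**THE BEHIND-TAIL (FROZEN-WAKE) THEOREM `pseudoFlowOnShift_behind_tail`.** Data: a nearest-neighbour
shift set `𝕊` (tree: `S`, `S♭`), `ε₀ ≥ 0`, a pseudo-flow `(S, F)` on `[0, τ]` with motion defect `κ₁ ≥ 0`,
a sub-window `[0, σ] ⊆ [0, τ]`, a bottom window shell `kb`, an amplitude ENVELOPE `Z_j > 0` for the shells
`j ≤ kb` bounded below by `Zmin > 0` behind the window, a bound `Cα` on the row sums `∑|α_{··i·}|_𝕊`,
and defect allowances `δ_j`. Hypotheses: the window's bottom shell obeys `|S_{i,kb}| ≤ Z_kb` on `[0, σ]`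
(what a window certificate's hull clause provides); the deep shells START at half envelope,
`|S₀_{i,j}| ≤ Z_j/2` (`j < kb`); the motion defect is allowed for, `κ₁ (1+ε₀)^{2j} √F_{i,j} ≤ δ_j` on `[0,σ]`
(`0` for exact flows); and the scalar CLOSING CONDITION per deep shell
`σ · (8 Cα (1+ε₀)^{5j/2} Ẑ_j² + δ_j) ≤ Z_j/2`, `Ẑ_j := max(Z_{j−1}, Z_j, Z_{j+1})` — small clocks
`(1+ε₀)^{5j/2}` behind make it hold for envelopes growing at most geometrically with depth (TameBehind).
Conclusion: every deep shell stays in its envelope and drifts by at most half of it,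
`|S_{i,j}(u)| ≤ Z_j` and `|S_{i,j}(u) − S₀_{i,j}| ≤ σ (8 Cα (1+ε₀)^{5j/2} Ẑ_j² + δ_j) ≤ Z_j/2` for `j < kb`,
`u ∈ [0, σ]`.

PROOF. Continuous induction over the INFINITE family of deep modes with the tree's uniform bootstrap
lemma `GappedFrontRobust.bootstrap_family` (scales `p = Z`, `ψ ≡ 1`): the a priori class (4.5) gives ONE
Lipschitz constant for all deep amplitudes (clocks `≤ (1+ε₀)^{5kb/2}` behind), uniform relative to
`Z ≥ Zmin`; the improvement step is the three-shell bound `abs_quadTermOn_le_three_shell` at the doubled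
envelope plus the motion law (4.8) (`pseudoFlowOnShift_abs_sub_le` on `[0, t]`).

HONEST FRAMING: a lemma about Tao-type MODEL lattice pseudo-flows on a general nearest-neighbour shift
set (Tao 2016 §4 Lemma 4.1 (4.5), (4.8); §6.2 Prop. 6.3 (viii) shape: the transition state behind the
front); nothing here is a statement about the Navier–Stokes equations, nothing is asserted about any
table, and no certificate is produced. p1 g11.
-/

noncomputable section

-- the sub-problem namespace `Summit.NavierStokesRegularity.NavierStokesRegularity` repeats the summit name by design (D-0017)
set_option linter.dupNamespace false

namespace Summit.NavierStokesRegularity.NavierStokesRegularity.Theorems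

open Set MeasureTheory intervalIntegral Literature.Analysis.FluidPDE Literature.Analysis.FluidPDE.TaoCascade

namespace GappedFrontRobustOn

variable {m : ℕ} {𝕊 : Finset (ℤ × ℤ × ℤ)}
variable {τ ε₀ : ℝ} {α : Fin m → Fin m → Fin m → ℤ × ℤ × ℤ → ℝ} {κ₁ κ₂ : ℝ}
  {S₀ F₀ B₀ : Fin m → ℤ → ℝ} {S F : Fin m → ℤ → ℝ → ℝ}

/-- **Drift of one shell from a three-shell envelope** (nearest-neighbour `𝕊`, `ε₀ ≥ 0`): along a
pseudo-flow on `[0, t]` (`t > 0`), if the three shells `j−1, j, j+1` obey `|S_{i',k}(s)| ≤ A` on `[0, t]`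
(`A ≥ 0`), the row sums are `≤ Cα`, and the motion defect of mode `(i, j)` is `≤ δ` there, then
`|S_{i,j}(t) − S₀_{i,j}| ≤ t · (2 Cα (1+ε₀)^{5j/2} A² + δ)`. [cite: Tao2016AveragedNS, §4 Lemma 4.1 (4.8)] -/
theorem pseudoFlowOnShift_drift_le (h𝕊 : IsNearestNeighbourSet 𝕊) {t : ℝ}
    (h : PseudoFlowOnShift 𝕊 t ε₀ α κ₁ κ₂ S₀ F₀ B₀ S F) (hε : 0 ≤ ε₀) (ht : 0 < t) (i : Fin m)
    (j : ℤ) {A Cα δ : ℝ} (hA0 : 0 ≤ A) (hCα : ∑ i₁, ∑ i₂, ∑ μ ∈ 𝕊, |α i₁ i₂ i μ| ≤ Cα)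
    (hA : ∀ s ∈ Icc 0 t, ∀ (i' : Fin m) (k : ℤ), j - 1 ≤ k → k ≤ j + 1 → |S i' k s| ≤ A)
    (hδ : ∀ s ∈ Icc 0 t, κ₁ * (1 + ε₀) ^ ((2 : ℝ) * j) * Real.sqrt (F i j s) ≤ δ) :
    |S i j t - S₀ i j| ≤ t * (2 * Cα * (1 + ε₀) ^ ((5 : ℝ) * j / 2) * A * A + δ) := by
  have hΛ : 0 ≤ (1 + ε₀) ^ ((5 : ℝ) * j / 2) := (Real.rpow_pos_of_pos (by linarith) _).le
  have hL : ∀ u ∈ Icc 0 t, |quadTermOn 𝕊 ε₀ α S i j u| +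
      κ₁ * (1 + ε₀) ^ ((2 : ℝ) * j) * Real.sqrt (F i j u) ≤
      2 * Cα * (1 + ε₀) ^ ((5 : ℝ) * j / 2) * A * A + δ := by
    intro u hu
    have h1 := abs_quadTermOn_le_three_shell h𝕊 hε α S i j u hA0 (fun i' k hk1 hk2 => hA u hu i' k hk1 hk2)
    have h2 : 2 * (∑ i₁, ∑ i₂, ∑ μ ∈ 𝕊, |α i₁ i₂ i μ|) * (1 + ε₀) ^ ((5 : ℝ) * j / 2) * A * A ≤
        2 * Cα * (1 + ε₀) ^ ((5 : ℝ) * j / 2) * A * A := by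
      have : 0 ≤ (1 + ε₀) ^ ((5 : ℝ) * j / 2) * A * A := by positivity
      nlinarith
    linarith [hδ u hu]
  have := pseudoFlowOnShift_abs_sub_le h i j hL (left_mem_Icc.2 ht.le) (right_mem_Icc.2 ht.le)
  rw [h.init_S i j, sub_zero, abs_of_pos ht] at this
  linarith

/-- **THE FROZEN WAKE (behind-tail theorem).** See the module docstring.
[cite: Tao2016AveragedNS, §4 Lemma 4.1 (4.5), (4.8) and §6.2 Prop. 6.3 (viii) (statement shape)] -/
theorem pseudoFlowOnShift_behind_tail (h𝕊 : IsNearestNeighbourSet 𝕊)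
    (h : PseudoFlowOnShift 𝕊 τ ε₀ α κ₁ κ₂ S₀ F₀ B₀ S F) (hε : 0 ≤ ε₀) (hκ₁ : 0 ≤ κ₁)
    {σ : ℝ} (hσ : 0 < σ) (hστ : σ ≤ τ) {kb : ℤ} {Z δ : ℤ → ℝ} {Cα Zmin : ℝ}
    (hCα : ∀ i, ∑ i₁, ∑ i₂, ∑ μ ∈ 𝕊, |α i₁ i₂ i μ| ≤ Cα)
    (hZ : ∀ j, j ≤ kb → 0 < Z j) (hZmin : 0 < Zmin) (hZmin' : ∀ j, j < kb → Zmin ≤ Z j)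
    (hwin : ∀ i, ∀ u ∈ Icc 0 σ, |S i kb u| ≤ Z kb)
    (h0 : ∀ (i : Fin m) (j : ℤ), j < kb → |S₀ i j| ≤ Z j / 2)
    (hδ : ∀ (i : Fin m) (j : ℤ), j < kb → ∀ u ∈ Icc 0 σ,
      κ₁ * (1 + ε₀) ^ ((2 : ℝ) * j) * Real.sqrt (F i j u) ≤ δ j)
    (hclose : ∀ j, j < kb →
      σ * (8 * Cα * (1 + ε₀) ^ ((5 : ℝ) * j / 2) *
        max (Z (j - 1)) (max (Z j) (Z (j + 1))) * max (Z (j - 1)) (max (Z j) (Z (j + 1))) + δ j) ≤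
        Z j / 2) :
    ∀ (i : Fin m) (j : ℤ), j < kb → ∀ u ∈ Icc 0 σ,
      |S i j u| ≤ Z j ∧
        |S i j u - S₀ i j| ≤ σ * (8 * Cα * (1 + ε₀) ^ ((5 : ℝ) * j / 2) *
          max (Z (j - 1)) (max (Z j) (Z (j + 1))) * max (Z (j - 1)) (max (Z j) (Z (j + 1))) + δ j) := by
  have hq : 0 < 1 + ε₀ := by linarith
  have hq1 : 1 ≤ 1 + ε₀ := by linarith
  -- notation: the three-shell envelope and the drift rate
  set zh : ℤ → ℝ := fun j => max (Z (j - 1)) (max (Z j) (Z (j + 1))) with hzh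
  have hzh_ge : ∀ j k, j - 1 ≤ k → k ≤ j + 1 → Z k ≤ zh j := by
    intro j k hk1 hk2
    have hk : k = j - 1 ∨ k = j ∨ k = j + 1 := by omega
    rcases hk with rfl | rfl | rfl
    · exact le_max_left _ _
    · exact (le_max_left _ _).trans (le_max_right _ _)
    · exact (le_max_right _ _).trans (le_max_right _ _)
  have hzh_pos : ∀ j, j < kb → 0 < zh j := fun j hj =>
    lt_of_lt_of_le (hZ j hj.le) (hzh_ge j j (by omega) (by omega))
  -- the flow on the sub-window `[0, σ]` and its a priori bounds
  have hσ' := pseudoFlowOnShift_mono h hσ hστ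
  obtain ⟨M, hM0, hM⟩ := pseudoFlowOnShift_uniform_bounds hσ' hq
  intro i₀ j₀ hj₀ u₀ hu₀
  have hCα0 : 0 ≤ Cα := le_trans (Finset.sum_nonneg fun _ _ => Finset.sum_nonneg fun _ _ =>
    Finset.sum_nonneg fun _ _ => abs_nonneg _) (hCα i₀)
  have hδ0 : ∀ j, j < kb → 0 ≤ δ j := fun j hj =>
    le_trans (mul_nonneg (mul_nonneg hκ₁ (Real.rpow_pos_of_pos hq _).le) (Real.sqrt_nonneg _))
      (hδ i₀ j hj 0 (left_mem_Icc.2 hσ.le))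
  -- ONE Lipschitz constant for every deep amplitude (clocks `≤ (1+ε₀)^{5kb/2}` behind)
  set L₀ : ℝ := 2 * Cα * (1 + ε₀) ^ ((5 : ℝ) * kb / 2) * M * M + κ₁ * (1 + ε₀) ^ ((2 : ℝ) * kb) * M
    with hL₀
  have hL₀0 : 0 ≤ L₀ := by positivity
  have hlipS : ∀ (i : Fin m) (j : ℤ), j < kb → ∀ s ∈ Icc 0 σ, ∀ t ∈ Icc 0 σ,
      |S i j t - S i j s| ≤ L₀ * |t - s| := by
    intro i j hj s hs t ht
    refine pseudoFlowOnShift_abs_sub_le hσ' i j (fun u hu => ?_) hs ht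
    have h1 := abs_quadTermOn_le_of_uniform h𝕊 hε α S i j u (fun j' k => (hM u hu j' k).1)
    have hΛle : (1 + ε₀) ^ ((5 : ℝ) * j / 2) ≤ (1 + ε₀) ^ ((5 : ℝ) * kb / 2) :=
      Real.rpow_le_rpow_of_exponent_le hq1 (by
        have : (j : ℝ) ≤ kb := by exact_mod_cast hj.le
        linarith)
    have h2le : (1 + ε₀) ^ ((2 : ℝ) * j) ≤ (1 + ε₀) ^ ((2 : ℝ) * kb) :=
      Real.rpow_le_rpow_of_exponent_le hq1 (by
        have : (j : ℝ) ≤ kb := by exact_mod_cast hj.le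
        linarith)
    have h3 : 2 * (∑ i₁, ∑ i₂, ∑ μ ∈ 𝕊, |α i₁ i₂ i μ|) * (1 + ε₀) ^ ((5 : ℝ) * j / 2) * M * M ≤
        2 * Cα * (1 + ε₀) ^ ((5 : ℝ) * kb / 2) * M * M := by
      have hs0 : 0 ≤ ∑ i₁, ∑ i₂, ∑ μ ∈ 𝕊, |α i₁ i₂ i μ| := Finset.sum_nonneg fun _ _ =>
        Finset.sum_nonneg fun _ _ => Finset.sum_nonneg fun _ _ => abs_nonneg _
      have hΛ0 : 0 ≤ (1 + ε₀) ^ ((5 : ℝ) * j / 2) := (Real.rpow_pos_of_pos hq _).le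
      have := mul_le_mul (hCα i) hΛle hΛ0 hCα0
      nlinarith [mul_nonneg hM0 hM0]
    have h4 : κ₁ * (1 + ε₀) ^ ((2 : ℝ) * j) * Real.sqrt (F i j u) ≤
        κ₁ * (1 + ε₀) ^ ((2 : ℝ) * kb) * M := by
      have := (hM u hu i j).2.2.1
      have h2pos : 0 ≤ (1 + ε₀) ^ ((2 : ℝ) * j) := (Real.rpow_pos_of_pos hq _).le
      calc κ₁ * (1 + ε₀) ^ ((2 : ℝ) * j) * Real.sqrt (F i j u)
          ≤ κ₁ * (1 + ε₀) ^ ((2 : ℝ) * j) * M :=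
            mul_le_mul_of_nonneg_left this (mul_nonneg hκ₁ h2pos)
        _ ≤ κ₁ * (1 + ε₀) ^ ((2 : ℝ) * kb) * M := by
            have := mul_le_mul_of_nonneg_left h2le hκ₁
            exact mul_le_mul_of_nonneg_right this hM0
    simp only [hL₀]
    linarith
  -- the improvement step: from the doubled envelope on `[0, t]` to the drift bound at `t`
  have improve : ∀ t ∈ Icc 0 σ,
      (∀ (i : Fin m) (j : ℤ), j < kb → ∀ s ∈ Icc 0 t, |S i j s| ≤ 2 * Z j) →
        ∀ (i : Fin m) (j : ℤ), j < kb →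
          |S i j t - S₀ i j| ≤ t * (8 * Cα * (1 + ε₀) ^ ((5 : ℝ) * j / 2) * zh j * zh j + δ j) := by
    intro t ht hyp i j hj
    rcases eq_or_lt_of_le ht.1 with ht0 | ht0
    · rw [← ht0, h.init_S, sub_self, abs_zero, zero_mul]
    have hflow := pseudoFlowOnShift_mono h ht0 (ht.2.trans hστ)
    have hA : ∀ s ∈ Icc 0 t, ∀ (i' : Fin m) (k : ℤ), j - 1 ≤ k → k ≤ j + 1 →
        |S i' k s| ≤ 2 * zh j := by
      intro s hs i' k hk1 hk2
      have hzk := hzh_ge j k hk1 hk2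
      rcases lt_or_ge k kb with hk | hk
      · exact (hyp i' k hk s hs).trans (by linarith)
      · have hkeq : k = kb := by omega
        subst hkeq
        have := hwin i' s ⟨hs.1, hs.2.trans ht.2⟩
        linarith [hZ k le_rfl]
    have hd := pseudoFlowOnShift_drift_le h𝕊 hflow hε ht0 i j (A := 2 * zh j) (Cα := Cα) (δ := δ j)
      (by linarith [hzh_pos j hj]) (hCα i) hA (fun s hs => hδ i j hj s ⟨hs.1, hs.2.trans ht.2⟩)
    refine hd.trans (le_of_eq ?_)
    ring
  -- continuous induction over the infinite family of deep modes (uniform bootstrap lemma)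
  have key := GappedFrontRobust.bootstrap_family (ι := Fin m × {j : ℤ // j < kb})
    (u := fun ij t => |S ij.1 ij.2.1 t|) (p := fun ij => Z ij.2.1) (ψ := fun _ => (1 : ℝ))
    (τ := σ) (L := L₀ / Zmin)
    (fun ij => (hZ ij.2.1 ij.2.2.le).le) (div_nonneg hL₀0 hZmin.le) continuousOn_const
    (fun _ _ => one_pos)
    (by
      rintro ⟨i, j, hj⟩ s hs t ht
      have h1 := abs_abs_sub_abs_le_abs_sub (S i j t) (S i j s)
      have h2 := hlipS i j hj s hs t ht
      have h3 : L₀ ≤ L₀ / Zmin * Z j := by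
        rw [div_mul_eq_mul_div, le_div_iff₀ hZmin]
        exact mul_le_mul_of_nonneg_left (hZmin' j hj) hL₀0
      have h4 : L₀ * |t - s| ≤ L₀ / Zmin * Z j * |t - s| :=
        mul_le_mul_of_nonneg_right h3 (abs_nonneg _)
      exact h1.trans (h2.trans h4))
    (by
      rintro ⟨i, j, hj⟩
      simp only [one_mul, h.init_S]
      linarith [h0 i j hj, hZ j hj.le])
    (by
      rintro t ht hyp ⟨i, j, hj⟩
      have hyp' : ∀ (i : Fin m) (j : ℤ), j < kb → ∀ s ∈ Icc 0 t, |S i j s| ≤ 2 * Z j :=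
        fun i' j' hj' s hs => by simpa using hyp ⟨i', j', hj'⟩ s hs
      have hd := improve t ht hyp' i j hj
      have hcl := hclose j hj
      have hrate : 0 ≤ 8 * Cα * (1 + ε₀) ^ ((5 : ℝ) * j / 2) * zh j * zh j + δ j := by
        have := hzh_pos j hj; have := hδ0 j hj; positivity
      have htσ : t * (8 * Cα * (1 + ε₀) ^ ((5 : ℝ) * j / 2) * zh j * zh j + δ j) ≤
          σ * (8 * Cα * (1 + ε₀) ^ ((5 : ℝ) * j / 2) * zh j * zh j + δ j) :=
        mul_le_mul_of_nonneg_right ht.2 hrate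
      have htri : |S i j t| ≤ |S₀ i j| + |S i j t - S₀ i j| := by
        have := abs_add_le (S₀ i j) (S i j t - S₀ i j); rwa [add_sub_cancel] at this
      simp only [one_mul]
      linarith [h0 i j hj])
  -- read off the two conclusions
  have hall : ∀ (i : Fin m) (j : ℤ), j < kb → ∀ s ∈ Icc 0 σ, |S i j s| ≤ Z j :=
    fun i j hj s hs => by simpa using key ⟨i, j, hj⟩ s hs
  refine ⟨hall i₀ j₀ hj₀ u₀ hu₀, ?_⟩
  have hd := improve u₀ hu₀ (fun i j hj s hs => (hall i j hj s ⟨hs.1, hs.2.trans hu₀.2⟩).trans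
    (by linarith [hZ j hj.le])) i₀ j₀ hj₀
  have hrate : 0 ≤ 8 * Cα * (1 + ε₀) ^ ((5 : ℝ) * j₀ / 2) * zh j₀ * zh j₀ + δ j₀ := by
    have := hzh_pos j₀ hj₀; have := hδ0 j₀ hj₀; positivity
  exact hd.trans (mul_le_mul_of_nonneg_right hu₀.2 hrate)

end GappedFrontRobustOn

end Summit.NavierStokesRegularity.NavierStokesRegularity.Theorems

end
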